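import Summits.CriticalPhenomena.Ising3DConformalLimit.Theorems.HyperoctahedralRPLimitRotationInvariantQuarterTurnDefs
import Summits.CriticalPhenomena.Ising3DConformalLimit.Theorems.MoebiusLimitExists.Negative.FreePermutations
import Literature.Geometry.Euclidean.AxisRotationsGenerate
import HarnessLib

/-!
# Crux `HyperoctahedralRP.LimitRotationInvariant` (stmt-CriticalPhenomena-1980), line `quarter-turn-liouville`:
# stub S6 `stub_fourfoldToFull` — from axis-generic `e₂`-invariance to `O(3)` invariance at level `n`

THEOREM-ONLY file (vocabulary from `…Theorems.HyperoctahedralRPLimitRotationInvariantQuarterTurnDefs`).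
The last step of the line's induction: Liouville (S4 + periodicity) gives invariance of `S n` under the
rotations `rot θ = planeRot 0 θ` about the lattice axis `e₂` at AXIS-GENERIC configurations only; from
the free structure of a limit (`LimitStructure`: normalisation off `NonCoincident`, continuity on
`NonCoincident`, hyperoctahedral invariance) this is upgraded to invariance under every linear isometry
of `ℝ³` at level `n` (`RotInvAt S n`).

1. DENSITY (`eventually_axisGeneric`).  Along the curve `t ↦ x + t v`, `v_i = (i, i², 0)`, every defining
   condition of `AxisGeneric` is the non-vanishing of a real polynomial in `t` of degree `≤ 4` whose top
   coefficient is independent of `x` and non-zero (`quadratic_lead_ne_zero`, `quartic_lead_ne_zero`: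
   `(i-j)(k-l)(1+(i+j)(k+l))` and `(i-j)²(k-l)²(1+ab+a-b)(1+ab-a+b)`, `a = i+j ≥ 1`, `b = k+l ≥ 1`), so it
   holds for all `t ≠ 0` near `0` (`eventually_quartic_ne_zero`, finiteness of the root set).
2. CONTINUITY EXTENSION (`rot_apply_eq_of_axisGeneric`).  `x ↦ S n (rot θ ∘ x)` and `S n` are continuous
   on the open set `NonCoincident` (`rot θ` preserves it) and agree along the curves, hence at the limit
   `t → 0, t ≠ 0`; off `NonCoincident` both vanish.
3. OTHER AXIS (`planeRot_one_apply_eq`).  `planeRot 1 θ = g ∘ rot θ ∘ g` for the coordinate transposition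
   `g = (1 2) ∈ O_h` (`planeRot_one_eq_conj`).
4. GENERATION (`stub_fourfoldToFull`).  The coordinate reflection `x ↦ (−x₀, x₁, x₂)` is the signed
   permutation `(−,+,+) ∈ O_h`; rotations about two coordinate axes and one coordinate reflection
   generate `O(3)` (Cartan–Dieudonné; tree `Literature.Geometry.Euclidean.apply_comp_eq_of_axisRotations`).
-/

noncomputable section

open scoped BigOperators
open Literature.Probability.LatticeModels
open Literature.MathematicalPhysics.QuantumFieldTheory

namespace Summit.CriticalPhenomena.Ising3DConformalLimit.Cruxes.LimitRotationInvariant.QuarterTurnLiouville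

open scoped Topology
open Filter Polynomial

/-! ## (1) Density of the axis-generic configurations along a polynomial curve -/

/-- A non-zero real polynomial does not vanish on a punctured neighbourhood of `0` (its zero set is
finite). [folklore] -/
theorem eventually_eval_ne_zero {p : ℝ[X]} (hp : p ≠ 0) : ∀ᶠ t in 𝓝[≠] (0 : ℝ), p.eval t ≠ 0 := by
  have hfin : Set.Finite ({t : ℝ | p.IsRoot t} \ {0}) :=
    (Polynomial.finite_setOf_isRoot hp).subset fun t ht => ht.1
  have h0 : (0 : ℝ) ∉ {t : ℝ | p.IsRoot t} \ {0} := fun h => h.2 rfl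
  have h1 : ({t : ℝ | p.IsRoot t} \ {0})ᶜ ∈ 𝓝[≠] (0 : ℝ) :=
    mem_nhdsWithin_of_mem_nhds (hfin.isClosed.isOpen_compl.mem_nhds h0)
  filter_upwards [h1, self_mem_nhdsWithin] with t ht ht0
  exact fun hpt => ht ⟨hpt, ht0⟩

/-- A real quartic with a non-zero coefficient does not vanish on a punctured neighbourhood of `0`.
[folklore] -/
theorem eventually_quartic_ne_zero (c₀ c₁ c₂ c₃ c₄ : ℝ)
    (h : c₀ ≠ 0 ∨ c₁ ≠ 0 ∨ c₂ ≠ 0 ∨ c₃ ≠ 0 ∨ c₄ ≠ 0) :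
    ∀ᶠ t in 𝓝[≠] (0 : ℝ), c₀ + c₁ * t + c₂ * t ^ 2 + c₃ * t ^ 3 + c₄ * t ^ 4 ≠ 0 := by
  set p : ℝ[X] := C c₀ + C c₁ * X + C c₂ * X ^ 2 + C c₃ * X ^ 3 + C c₄ * X ^ 4 with hp_def
  have hp : p ≠ 0 := by
    intro hp
    have e0 := congr_arg (fun q : ℝ[X] => q.coeff 0) hp
    have e1 := congr_arg (fun q : ℝ[X] => q.coeff 1) hp
    have e2 := congr_arg (fun q : ℝ[X] => q.coeff 2) hp
    have e3 := congr_arg (fun q : ℝ[X] => q.coeff 3) hp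
    have e4 := congr_arg (fun q : ℝ[X] => q.coeff 4) hp
    simp only [hp_def, coeff_add, coeff_C_mul, coeff_X_pow, coeff_C, coeff_X, coeff_zero] at e0 e1 e2 e3 e4
    norm_num at e0 e1 e2 e3 e4
    tauto
  have hev : ∀ t : ℝ, p.eval t = c₀ + c₁ * t + c₂ * t ^ 2 + c₃ * t ^ 3 + c₄ * t ^ 4 := fun t => by
    simp [hp_def]
  filter_upwards [eventually_eval_ne_zero hp] with t ht
  rwa [hev] at ht

/-- The leading coefficient of the quartic clause of `AxisGeneric` along the curve `t ↦ x + t v`,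
`v_i = (i, i², 0)`: with `β = i - j ≠ 0`, `δ = k - l ≠ 0`, `a = i + j ≥ 1`, `b = k + l ≥ 1` it is
`β²δ²(1 + ab + a - b)(1 + ab - a + b) ≠ 0`. [folklore] -/
theorem quartic_lead_ne_zero {i j k l : ℝ} (hij : i ≠ j) (hkl : k ≠ l) (ha : 1 ≤ i + j)
    (hb : 1 ≤ k + l) :
    ((i - j) * (k - l) + (i ^ 2 - j ^ 2) * (k ^ 2 - l ^ 2)) ^ 2 -
      ((i - j) * (k ^ 2 - l ^ 2) - (i ^ 2 - j ^ 2) * (k - l)) ^ 2 ≠ 0 := by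
  have hf1 : 0 < 1 + (i + j) * (k + l) + (i + j) - (k + l) := by
    nlinarith [mul_nonneg (by linarith : (0:ℝ) ≤ k + l) (by linarith : (0:ℝ) ≤ i + j - 1)]
  have hf2 : 0 < 1 + (i + j) * (k + l) - (i + j) + (k + l) := by
    nlinarith [mul_nonneg (by linarith : (0:ℝ) ≤ i + j) (by linarith : (0:ℝ) ≤ k + l - 1)]
  rw [show ((i - j) * (k - l) + (i ^ 2 - j ^ 2) * (k ^ 2 - l ^ 2)) ^ 2 -
      ((i - j) * (k ^ 2 - l ^ 2) - (i ^ 2 - j ^ 2) * (k - l)) ^ 2 =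
      (i - j) ^ 2 * (k - l) ^ 2 * ((1 + (i + j) * (k + l) + (i + j) - (k + l)) *
        (1 + (i + j) * (k + l) - (i + j) + (k + l))) by ring]
  exact mul_ne_zero (mul_ne_zero (pow_ne_zero 2 (sub_ne_zero.2 hij)) (pow_ne_zero 2 (sub_ne_zero.2 hkl)))
    (mul_pos hf1 hf2).ne'

/-- The quadratic leading coefficient of the `pdot` clause along the same curve is
`(i - j)(k - l)(1 + (i + j)(k + l)) ≠ 0`. [folklore] -/
theorem quadratic_lead_ne_zero {i j k l : ℝ} (hij : i ≠ j) (hkl : k ≠ l) (hi : 0 ≤ i) (hj : 0 ≤ j)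
    (hk : 0 ≤ k) (hl : 0 ≤ l) :
    (i - j) * (k - l) + (i ^ 2 - j ^ 2) * (k ^ 2 - l ^ 2) ≠ 0 := by
  have hf : 0 < 1 + (i + j) * (k + l) := by nlinarith [mul_nonneg (add_nonneg hi hj) (add_nonneg hk hl)]
  rw [show (i - j) * (k - l) + (i ^ 2 - j ^ 2) * (k ^ 2 - l ^ 2) =
      (i - j) * (k - l) * (1 + (i + j) * (k + l)) by ring]
  exact mul_ne_zero (mul_ne_zero (sub_ne_zero.2 hij) (sub_ne_zero.2 hkl)) hf.ne'

/-- **Density of `AxisGeneric` along a curve.**  For every configuration `x`, the perturbed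
configuration `x + t v` with `v_i = (i, i², 0)` is axis-generic for all `t ≠ 0` small enough: each
defining condition is the non-vanishing of a real polynomial in `t` of degree `≤ 4` whose top
coefficient does not depend on `x` and is non-zero. [folklore] -/
theorem eventually_axisGeneric {n : ℕ} (x : Fin n → EuclideanSpace ℝ (Fin 3)) :
    ∀ᶠ t in 𝓝[≠] (0 : ℝ), AxisGeneric (fun i : Fin n =>
      x i + t • (WithLp.toLp 2 ![((i : ℕ) : ℝ), ((i : ℕ) : ℝ) ^ 2, 0] : EuclideanSpace ℝ (Fin 3))) := by
  have c0 : ∀ (t : ℝ) (i : Fin n),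
      (x i + t • (WithLp.toLp 2 ![((i : ℕ) : ℝ), ((i : ℕ) : ℝ) ^ 2, 0] : EuclideanSpace ℝ (Fin 3))) 0 =
        x i 0 + t * (i : ℕ) := by
    intro t i; simp
  have c1 : ∀ (t : ℝ) (i : Fin n),
      (x i + t • (WithLp.toLp 2 ![((i : ℕ) : ℝ), ((i : ℕ) : ℝ) ^ 2, 0] : EuclideanSpace ℝ (Fin 3))) 1 =
        x i 1 + t * ((i : ℕ) : ℝ) ^ 2 := by
    intro t i; simp
  have hcast : ∀ {i j : Fin n}, i ≠ j → ((i : ℕ) : ℝ) ≠ ((j : ℕ) : ℝ) := fun hij =>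
    fun h => hij (Fin.ext (by exact_mod_cast h))
  have hsum : ∀ {i j : Fin n}, i ≠ j → (1 : ℝ) ≤ (i : ℕ) + (j : ℕ) := by
    intro i j hij
    have : 1 ≤ (i : ℕ) + (j : ℕ) := by
      rcases Nat.eq_zero_or_pos (i : ℕ) with hi | hi
      · have : (j : ℕ) ≠ 0 := fun hj => hij (Fin.ext (by rw [hi, hj]))
        omega
      · omega
    exact_mod_cast this
  refine Filter.Eventually.and ?_ ?_
  · refine eventually_all.2 fun i => eventually_all.2 fun j => ?_
    by_cases hij : i = j
    · exact Eventually.of_forall fun t h => absurd hij h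
    filter_upwards [eventually_quartic_ne_zero (x i 0 - x j 0) ((i : ℕ) - (j : ℕ)) 0 0 0
      (Or.inr (Or.inl (sub_ne_zero.2 (hcast hij))))] with t ht
    intro _
    left
    intro h
    apply ht
    rw [c0, c0] at h
    linear_combination h
  · refine eventually_all.2 fun i => eventually_all.2 fun j =>
      eventually_all.2 fun k => eventually_all.2 fun l => ?_
    by_cases hij : i = j
    · exact Eventually.of_forall fun t h => absurd hij h
    by_cases hkl : k = l
    · exact Eventually.of_forall fun t _ h => absurd hkl h
    -- the two planar forms along the curve are explicit quadratics in `t`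
    obtain ⟨p₀, p₁, p₂, q₀, q₁, q₂, hpd, hpc, hp₂, h₄⟩ : ∃ p₀ p₁ p₂ q₀ q₁ q₂ : ℝ,
        (∀ t : ℝ, pdot
          ((x i + t • (WithLp.toLp 2 ![((i : ℕ) : ℝ), ((i : ℕ) : ℝ) ^ 2, 0] : EuclideanSpace ℝ (Fin 3))) -
            (x j + t • (WithLp.toLp 2 ![((j : ℕ) : ℝ), ((j : ℕ) : ℝ) ^ 2, 0] : EuclideanSpace ℝ (Fin 3))))
          ((x k + t • (WithLp.toLp 2 ![((k : ℕ) : ℝ), ((k : ℕ) : ℝ) ^ 2, 0] : EuclideanSpace ℝ (Fin 3))) -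
            (x l + t • (WithLp.toLp 2 ![((l : ℕ) : ℝ), ((l : ℕ) : ℝ) ^ 2, 0] : EuclideanSpace ℝ (Fin 3)))) =
          p₀ + p₁ * t + p₂ * t ^ 2) ∧
        (∀ t : ℝ, pcross
          ((x i + t • (WithLp.toLp 2 ![((i : ℕ) : ℝ), ((i : ℕ) : ℝ) ^ 2, 0] : EuclideanSpace ℝ (Fin 3))) -
            (x j + t • (WithLp.toLp 2 ![((j : ℕ) : ℝ), ((j : ℕ) : ℝ) ^ 2, 0] : EuclideanSpace ℝ (Fin 3))))
          ((x k + t • (WithLp.toLp 2 ![((k : ℕ) : ℝ), ((k : ℕ) : ℝ) ^ 2, 0] : EuclideanSpace ℝ (Fin 3))) -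
            (x l + t • (WithLp.toLp 2 ![((l : ℕ) : ℝ), ((l : ℕ) : ℝ) ^ 2, 0] : EuclideanSpace ℝ (Fin 3)))) =
          q₀ + q₁ * t + q₂ * t ^ 2) ∧
        p₂ ≠ 0 ∧ p₂ ^ 2 - q₂ ^ 2 ≠ 0 := by
      refine ⟨(x i 0 - x j 0) * (x k 0 - x l 0) + (x i 1 - x j 1) * (x k 1 - x l 1),
        (x i 0 - x j 0) * ((k : ℕ) - (l : ℕ)) + ((i : ℕ) - (j : ℕ)) * (x k 0 - x l 0) +
          (x i 1 - x j 1) * (((k : ℕ) : ℝ) ^ 2 - ((l : ℕ) : ℝ) ^ 2) +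
          (((i : ℕ) : ℝ) ^ 2 - ((j : ℕ) : ℝ) ^ 2) * (x k 1 - x l 1),
        ((i : ℕ) - (j : ℕ)) * ((k : ℕ) - (l : ℕ)) +
          (((i : ℕ) : ℝ) ^ 2 - ((j : ℕ) : ℝ) ^ 2) * (((k : ℕ) : ℝ) ^ 2 - ((l : ℕ) : ℝ) ^ 2),
        (x i 0 - x j 0) * (x k 1 - x l 1) - (x i 1 - x j 1) * (x k 0 - x l 0),
        (x i 0 - x j 0) * (((k : ℕ) : ℝ) ^ 2 - ((l : ℕ) : ℝ) ^ 2) + ((i : ℕ) - (j : ℕ)) * (x k 1 - x l 1) -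
          (x i 1 - x j 1) * ((k : ℕ) - (l : ℕ)) - (((i : ℕ) : ℝ) ^ 2 - ((j : ℕ) : ℝ) ^ 2) * (x k 0 - x l 0),
        ((i : ℕ) - (j : ℕ)) * (((k : ℕ) : ℝ) ^ 2 - ((l : ℕ) : ℝ) ^ 2) -
          (((i : ℕ) : ℝ) ^ 2 - ((j : ℕ) : ℝ) ^ 2) * ((k : ℕ) - (l : ℕ)),
        fun t => ?_, fun t => ?_,
        quadratic_lead_ne_zero (hcast hij) (hcast hkl) (Nat.cast_nonneg _) (Nat.cast_nonneg _)
          (Nat.cast_nonneg _) (Nat.cast_nonneg _),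
        quartic_lead_ne_zero (hcast hij) (hcast hkl) (hsum hij) (hsum hkl)⟩
      · simp only [pdot, PiLp.sub_apply, c0, c1]
        ring
      · simp only [pcross, PiLp.sub_apply, c0, c1]
        ring
    filter_upwards [eventually_quartic_ne_zero p₀ p₁ p₂ 0 0 (Or.inr (Or.inr (Or.inl hp₂))),
      eventually_quartic_ne_zero (p₀ ^ 2 - q₀ ^ 2) (2 * (p₀ * p₁ - q₀ * q₁))
        (p₁ ^ 2 + 2 * p₀ * p₂ - q₁ ^ 2 - 2 * q₀ * q₂) (2 * (p₁ * p₂ - q₁ * q₂)) (p₂ ^ 2 - q₂ ^ 2)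
        (Or.inr (Or.inr (Or.inr (Or.inr h₄))))] with t ht₂ ht₄
    intro _ _ _
    refine ⟨fun h => ht₂ ?_, fun h => ht₄ ?_⟩
    · rw [hpd t] at h
      linear_combination h
    · rw [hpd t, hpc t] at h
      linear_combination h

/-! ## (2) Continuity extension: invariance under all rotations about `e₂` -/

/-- **From axis-generic to all configurations.**  If `S n` vanishes off `NonCoincident`, is continuous
on `NonCoincident`, and is invariant under the rotations `rot θ` about `e₂` at every axis-generic
configuration, then it is invariant under `rot θ` at every configuration (density of `AxisGeneric`
along the curve of `eventually_axisGeneric`, uniqueness of limits along `𝓝[≠] 0`). [folklore] -/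
theorem rot_apply_eq_of_axisGeneric {S : CorrFamily 3} {n : ℕ}
    (hnorm : ∀ z : Fin n → EuclideanSpace ℝ (Fin 3), z ∉ NonCoincident 3 n → S n z = 0)
    (hcont : ContinuousOn (S n) (NonCoincident 3 n))
    (hgen : ∀ x : Fin n → EuclideanSpace ℝ (Fin 3), AxisGeneric x →
      ∀ θ : ℝ, S n (fun i => rot θ (x i)) = S n x)
    (θ : ℝ) (x : Fin n → EuclideanSpace ℝ (Fin 3)) : S n (fun i => rot θ (x i)) = S n x := by
  by_cases hx : x ∈ NonCoincident 3 n
  · -- the curve `t ↦ x + t v` tends to `x` along the punctured neighbourhood of `0`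
    have hγc : Continuous (fun t : ℝ => fun i : Fin n =>
        x i + t • (WithLp.toLp 2 ![((i : ℕ) : ℝ), ((i : ℕ) : ℝ) ^ 2, 0] : EuclideanSpace ℝ (Fin 3))) :=
      continuous_pi fun i => continuous_const.add (continuous_id.smul continuous_const)
    have hγ : Tendsto (fun t : ℝ => fun i : Fin n =>
        x i + t • (WithLp.toLp 2 ![((i : ℕ) : ℝ), ((i : ℕ) : ℝ) ^ 2, 0] : EuclideanSpace ℝ (Fin 3)))
        (𝓝[≠] 0) (𝓝 x) := by
      have h := (hγc.tendsto 0).mono_left (nhdsWithin_le_nhds (s := {(0 : ℝ)}ᶜ))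
      simpa using h
    have hΦ : Continuous (fun y : Fin n → EuclideanSpace ℝ (Fin 3) => fun i => rot θ (y i)) :=
      continuous_pi fun i => (rot θ).continuous.comp (continuous_apply i)
    have hxR : (fun i => rot θ (x i)) ∈ NonCoincident 3 n :=
      (MoebiusLimitExistsNegative.map_mem_nonCoincident_iff (rot θ) x).2 hx
    have h1 : Tendsto (fun t : ℝ => S n (fun i => rot θ
        (x i + t • (WithLp.toLp 2 ![((i : ℕ) : ℝ), ((i : ℕ) : ℝ) ^ 2, 0] : EuclideanSpace ℝ (Fin 3)))))
        (𝓝[≠] 0) (𝓝 (S n (fun i => rot θ (x i)))) :=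
      (hcont.continuousAt ((isOpen_nonCoincident 3 n).mem_nhds hxR)).tendsto.comp
        ((hΦ.tendsto x).comp hγ)
    have h2 : Tendsto (fun t : ℝ => S n (fun i =>
        x i + t • (WithLp.toLp 2 ![((i : ℕ) : ℝ), ((i : ℕ) : ℝ) ^ 2, 0] : EuclideanSpace ℝ (Fin 3))))
        (𝓝[≠] 0) (𝓝 (S n x)) :=
      (hcont.continuousAt ((isOpen_nonCoincident 3 n).mem_nhds hx)).tendsto.comp hγ
    exact tendsto_nhds_unique_of_eventuallyEq h1 h2
      ((eventually_axisGeneric x).mono fun t ht => hgen _ ht θ)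
  · have hx' : (fun i => rot θ (x i)) ∉ NonCoincident 3 n :=
      fun h => hx ((MoebiusLimitExistsNegative.map_mem_nonCoincident_iff (rot θ) x).1 h)
    rw [hnorm _ hx', hnorm _ hx]

/-! ## (3) The other lattice axis by hyperoctahedral conjugation -/

/-- The rotation about `e₁` (the tree's `planeRot 1 θ`, acting in the `(0,2)`-coordinate plane) is the
rotation `rot θ` about `e₂` conjugated by the coordinate transposition `(1 2) ∈ O_h`. [folklore] -/
theorem planeRot_one_eq_conj (θ : ℝ) (y : EuclideanSpace ℝ (Fin 3)) :
    planeRot (d := 2) 1 θ y = signedPerm (Equiv.swap 1 2) (fun _ => true)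
      (rot θ (signedPerm (Equiv.swap 1 2) (fun _ => true) y)) := by
  ext j
  fin_cases j <;> simp [signedPerm, planeRot_apply, Equiv.swap_apply_def]

/-- Hyperoctahedral invariance transfers `e₂`-rotation invariance to `e₁`-rotation invariance. [folklore] -/
theorem planeRot_one_apply_eq {S : CorrFamily 3} {n : ℕ} (hO : IsHyperoctahedralInvariant S)
    (hrot : ∀ (θ : ℝ) (x : Fin n → EuclideanSpace ℝ (Fin 3)), S n (fun i => rot θ (x i)) = S n x)
    (θ : ℝ) (x : Fin n → EuclideanSpace ℝ (Fin 3)) : S n (fun i => planeRot (d := 2) 1 θ (x i)) = S n x := by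
  simp only [planeRot_one_eq_conj]
  exact ((hO n _ _ _).trans (hrot θ _)).trans (hO n _ _ x)

/-! ## (4) The stub: Cartan–Dieudonné assembly -/

/-- **S6 · `stub_fourfoldToFull`.**  From `LimitStructure` (hyperoctahedral invariance, normalisation,
continuity of `S n` on `NonCoincident`) and invariance of `S n` under `rot θ` at every axis-generic
configuration: (1)–(2) `AxisGeneric` is dense along the polynomial curves `t ↦ x + t v`, `v_i = (i, i², 0)`
(`eventually_axisGeneric`), and `rot θ` preserves `NonCoincident`, so continuity extends the invariance to
`NonCoincident` and normalisation to all `x` (`rot_apply_eq_of_axisGeneric`); (3) conjugation by the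
coordinate transposition `(1 2) ∈ O_h` gives invariance under the rotations `planeRot 1 θ` about `e₁`
(`planeRot_one_apply_eq`); (4) the coordinate reflection `θ_{e₀}` is the signed permutation
`(−,+,+) ∈ O_h`, and rotations about two axes plus one coordinate reflection generate `O(3)`
(Cartan–Dieudonné; `Literature.Geometry.Euclidean.apply_comp_eq_of_axisRotations`). [folklore] -/
theorem stub_fourfoldToFull :
    ∀ (Δ : ℝ) (S : CorrFamily 3), LimitStructure Δ S → ∀ n : ℕ,
      (∀ x : Fin n → EuclideanSpace ℝ (Fin 3), AxisGeneric x → ∀ θ : ℝ, S n (fun i => rot θ (x i)) = S n x) →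
      RotInvAt S n := by
  intro Δ S hL n hgen R x
  obtain ⟨⟨-, -, -, hnorm, -, hO, -, -, hcont⟩, -⟩ := hL
  have hrot : ∀ (θ : ℝ) (y : Fin n → EuclideanSpace ℝ (Fin 3)), S n (fun i => rot θ (y i)) = S n y :=
    fun θ y => rot_apply_eq_of_axisGeneric (hnorm n) (hcont n) hgen θ y
  refine Literature.Geometry.Euclidean.apply_comp_eq_of_axisRotations (S n) ?_ ?_ ?_ R x
  · intro φ
    refine ⟨rot φ, fun y => ?_, hrot φ⟩
    ext j
    fin_cases j <;> simp [planeRot_apply]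
  · intro φ
    refine ⟨planeRot (d := 2) 1 φ, fun y => ?_, planeRot_one_apply_eq hO hrot φ⟩
    ext j
    fin_cases j <;> simp [planeRot_apply]
  · intro y
    have h := hO n 1 ![false, true, true] y
    have e : (fun i => signedPerm 1 ![false, true, true] (y i)) =
        fun i => (WithLp.toLp 2 ![-(y i) 0, y i 1, y i 2] : EuclideanSpace ℝ (Fin 3)) := by
      funext i
      ext j
      fin_cases j <;> simp [signedPerm]
    rw [e] at h
    exact h

end Summit.CriticalPhenomena.Ising3DConformalLimit.Cruxes.LimitRotationInvariant.QuarterTurnLiouville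

end
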